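import Literature.NumberTheory.Rogawski1990.ArchBouazizStableFamilySlabSmooth     -- ★ p850541 (this seat): `contDiffOn_stOrbFamH_inRegS` ([C1b] for general `fH`)
import Literature.NumberTheory.Rogawski1990.ArchBouazizStableFamilyCayleyRay      -- ★ p850429 (LH1-p04 (g4)): the ray `update s w₀ (x, θ₁, θ)`, `tendsto_update_ray_cayPt`, `eventually_update_ray_mem_regS_insert`, `cayPt_mem_inRegS_insert_of_semiregular`
import HarnessLib

/-!
# The Cayley value of the stable orbital family is a LIMIT — UNCONDITIONALLY for every `fH ∈ C_c^∞(H_∞)` (the (V1-H) readings of ★ `ArchBouazizStableFamilyCayleyRay`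
# with the membership hypothesis `ArchBzSmoothBounded` discharged by ★ [C1b] `contDiffOn_stOrbFamH_inRegS`)
# (Bouaziz 1994 §3.1 (I₂); Shelstad 1979 Lemma 4.3; Varadarajan 1989 §6.4 Thm 23)

Topic `NumberTheory/Rogawski1990`; namespace `Literature.NumberTheory.Rogawski1990`.  THEOREMS ONLY (no `def`, no instance, no axiom, no `sorry`).  Cell `pub/hodgecm-mathlib`,
crux H413 (`stmt-HodgeConjecture-24833`), line LH3 (closer stub `stub_N9`, DIRECT ROAD), organ O-L3′ conjunct (ii) pay-down for GENERAL `fH` (LH3-plan (g3) RULINGS #7 (d)).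
Author LH3-p01 (g4).  Count-neutral.

★ `ArchBouazizStableFamilyCayleyRay` (V1-H) reads the value of a family `Ψ (insert w₀ S)` at the Cayley point `cayPt w₀ s` of a semiregular wall point as the limit along
the ray `x ↦ update s w₀ (x, θ₁, θ)` — for families that are SMOOTH-BOUNDED (`h : ArchBzSmoothBounded Ψ`, i.e. the letter's membership clause (SB)).  Only the `C^∞`-on-`InRegS`
half of (SB) is used there, and for the stable orbital family `stOrbFamH L νH fH` of a test function that half is now PROVED (★ [C1b] `contDiffOn_stOrbFamH_inRegS`, Harish-Chandra's
smoothness through the split walls).  This file records the hypothesis-free readings: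
* §1 generic, from `ContDiffOn ℝ ∞ (Ψ S) (InRegS S)` alone: `continuousAt_of_contDiffOn_inRegS`, `tendsto_insert_cayPt_ray_nhds_of_contDiffOn`,
  `insert_cayPt_eq_of_tendsto_ray_of_le_of_contDiffOn`;
* §2 for `stOrbFamH L νH fH`, `fH ∈ C_c^∞(H_∞)` (★ `ArchSmooth₂`), NO membership hypothesis: **`continuousAt_stOrbFamH_of_mem_inRegS`**, **`tendsto_stOrbFamH_insert_cayPt_ray_nhds`**,
  `tendsto_stOrbFamH_insert_cayPt_ray`, **`stOrbFamH_insert_cayPt_eq_of_tendsto_ray_of_le`** (the Cayley value = any one-sided ∕ punctured ray limit of anything that agrees with the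
  family on `RegS (insert w₀ S)`).
HONEST LABEL: HC_CM is proved only modulo the 7 printed citations (2 remaining: hLiu418 = stmt-HodgeConjecture-24832, h413 = stmt-HodgeConjecture-24833) until rung 0 closes;
bookkeeping over ★ [C1b], pays nothing by itself.

## References
* [Bouaziz1994IntegralesOrbitales] A. Bouaziz, *Intégrales orbitales sur les algèbres de Lie réductives*, Invent. Math. 115 (1994), §3.1 (I₂) p. 579.
* [Shelstad1979] D. Shelstad, *Characters and inner forms of a quasi-split group over ℝ*, Compositio Math. 39 (1979), Lemma 4.3 p. 25.
* [Varadarajan1989] V. S. Varadarajan, *An Introduction to Harmonic Analysis on Semisimple Lie Groups* (1989), §6.4 Thm 23.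
-/

set_option autoImplicit false

noncomputable section

open MeasureTheory Filter Topology Set Function NumberField NumberField.InfinitePlace
open Literature.NumberTheory.Automorphic Literature.NumberTheory.Automorphic.UnitaryGroup Literature.NumberTheory.Automorphic.ArchCartan
open scoped ContDiff Classical

namespace Literature.NumberTheory.Rogawski1990

/-! ## §1 From `C^∞` on `InRegS` alone -/

section Generic

variable {W : Type*} [Fintype W] [DecidableEq W]

omit [DecidableEq W] in
/-- A family `C^∞` on the open set `InRegS S` is continuous at each of its points. [cite: Bouaziz1994IntegralesOrbitales, §3.1 (I₂) p. 579] -/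
theorem continuousAt_of_contDiffOn_inRegS {Ψ : (W → Fin 3 → ℝ) → ℂ} {S : Finset W} (h : ContDiffOn ℝ ∞ Ψ (InRegS S)) {c : W → Fin 3 → ℝ}
    (hc : c ∈ InRegS S) : ContinuousAt Ψ c :=
  h.continuousOn.continuousAt ((isOpen_inRegS S).mem_nhds hc)

/-- **THE CAYLEY VALUE IS THE RAY LIMIT** for a family `C^∞` on `InRegS (insert w₀ S)`, at a wall point `s` (`s w₀ 0 = s w₀ 2`) regular at the compact places `w ≠ w₀`:
`Ψ (update s w₀ (x, θ₁, θ)) → Ψ (cayPt w₀ s)` as `x → 0`. [cite: Bouaziz1994IntegralesOrbitales, §3.1 (I₂) p. 579] [cite: Shelstad1979, Lemma 4.3 p. 25] -/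
theorem tendsto_insert_cayPt_ray_nhds_of_contDiffOn {Ψ : (W → Fin 3 → ℝ) → ℂ} {S : Finset W} {w₀ : W} (h : ContDiffOn ℝ ∞ Ψ (InRegS (insert w₀ S)))
    {s : W → Fin 3 → ℝ} (hs : s w₀ 0 = s w₀ 2) (hreg : ∀ w, w ∉ S → w ≠ w₀ → Circle.exp (s w 0) ≠ Circle.exp (s w 2)) :
    Tendsto (fun x : ℝ => Ψ (Function.update s w₀ ![x, s w₀ 1, s w₀ 0])) (𝓝 0) (𝓝 (Ψ (cayPt w₀ s))) :=
  (continuousAt_of_contDiffOn_inRegS h (cayPt_mem_inRegS_insert_of_semiregular S w₀ hreg)).tendsto.comp (tendsto_update_ray_cayPt hs)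

/-- **EQUALITY FORM, any punctured sub-filter**: if `F` agrees with `Ψ` on `RegS (insert w₀ S)` and `F` along the ray tends to `ℓ` for a non-trivial `l ≤ 𝓝[≠] 0`, then
`Ψ (cayPt w₀ s) = ℓ` (the ray runs in `RegS (insert w₀ S)` for `x ≠ 0`; uniqueness of limits). [cite: Shelstad1979, Lemma 4.3 p. 25] -/
theorem insert_cayPt_eq_of_tendsto_ray_of_le_of_contDiffOn {Ψ : (W → Fin 3 → ℝ) → ℂ} {S : Finset W} {w₀ : W} (h : ContDiffOn ℝ ∞ Ψ (InRegS (insert w₀ S)))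
    {s : W → Fin 3 → ℝ} (hs : s w₀ 0 = s w₀ 2) (hreg : ∀ w, w ∉ S → w ≠ w₀ → Circle.exp (s w 0) ≠ Circle.exp (s w 2)) (hregS : ∀ w ∈ S, s w 0 ≠ 0)
    {F : (W → Fin 3 → ℝ) → ℂ} (hEq : EqOn Ψ F (RegS (insert w₀ S))) {l : Filter ℝ} [NeBot l] (hl : l ≤ 𝓝[≠] 0) {ℓ : ℂ}
    (hF : Tendsto (fun x : ℝ => F (Function.update s w₀ ![x, s w₀ 1, s w₀ 0])) l (𝓝 ℓ)) : Ψ (cayPt w₀ s) = ℓ := by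
  have h1 : Tendsto (fun x : ℝ => Ψ (Function.update s w₀ ![x, s w₀ 1, s w₀ 0])) l (𝓝 (Ψ (cayPt w₀ s))) :=
    (tendsto_insert_cayPt_ray_nhds_of_contDiffOn h hs hreg).mono_left (hl.trans nhdsWithin_le_nhds)
  have h2 : Tendsto (fun x : ℝ => Ψ (Function.update s w₀ ![x, s w₀ 1, s w₀ 0])) l (𝓝 ℓ) := by
    refine hF.congr' ?_
    have hev : ∀ᶠ x in l, Function.update s w₀ ![x, s w₀ 1, s w₀ 0] ∈ RegS (insert w₀ S) := hl (eventually_update_ray_mem_regS_insert hreg hregS)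
    filter_upwards [hev] with x hx
    exact (hEq hx).symm
  exact tendsto_nhds_unique h1 h2

end Generic

/-! ## §2 For the stable orbital family of a test function — no membership hypothesis -/

section Family

variable (L : Type) [Field L] [NumberField L] [IsCMField L]
  [MeasurableSpace (↥(arch (↥(maximalRealSubfield L)) L (IsCMField.complexConj L) 2 (Matrix.of fun i j : Fin 2 => if i.val + j.val + 1 = 2 then (1 : L) else 0)) ×
      ↥(arch (↥(maximalRealSubfield L)) L (IsCMField.complexConj L) 1 (Matrix.of fun i j : Fin 1 => if i.val + j.val + 1 = 1 then (1 : L) else 0)))]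
  [BorelSpace (↥(arch (↥(maximalRealSubfield L)) L (IsCMField.complexConj L) 2 (Matrix.of fun i j : Fin 2 => if i.val + j.val + 1 = 2 then (1 : L) else 0)) ×
      ↥(arch (↥(maximalRealSubfield L)) L (IsCMField.complexConj L) 1 (Matrix.of fun i j : Fin 1 => if i.val + j.val + 1 = 1 then (1 : L) else 0)))]
  (νH : Measure (↥(arch (↥(maximalRealSubfield L)) L (IsCMField.complexConj L) 2 (Matrix.of fun i j : Fin 2 => if i.val + j.val + 1 = 2 then (1 : L) else 0)) ×
      ↥(arch (↥(maximalRealSubfield L)) L (IsCMField.complexConj L) 1 (Matrix.of fun i j : Fin 1 => if i.val + j.val + 1 = 1 then (1 : L) else 0))))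
  [νH.IsHaarMeasure] [νH.IsMulRightInvariant]
  {fH : ↥(arch (↥(maximalRealSubfield L)) L (IsCMField.complexConj L) 2 (Matrix.of fun i j : Fin 2 => if i.val + j.val + 1 = 2 then (1 : L) else 0)) ×
      ↥(arch (↥(maximalRealSubfield L)) L (IsCMField.complexConj L) 1 (Matrix.of fun i j : Fin 1 => if i.val + j.val + 1 = 1 then (1 : L) else 0)) → ℂ}

/-- **The stable orbital family of a test function is continuous at every in-regular point** (through the real walls `x_w = 0`), unconditionally — ★ [C1b].
[cite: Varadarajan1989, §6.4 Thm 23] [cite: Bouaziz1994IntegralesOrbitales, §3.1 (I₂) p. 579] -/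
theorem continuousAt_stOrbFamH_of_mem_inRegS (hfH : ArchSmooth₂ L fH) (S : Finset {w : InfinitePlace L // IsComplex w})
    {c : {w : InfinitePlace L // IsComplex w} → Fin 3 → ℝ} (hc : c ∈ InRegS S) : ContinuousAt (stOrbFamH L νH fH S) c :=
  continuousAt_of_contDiffOn_inRegS (contDiffOn_stOrbFamH_inRegS L νH hfH S) hc

/-- **THE CAYLEY VALUE OF THE STABLE ORBITAL FAMILY IS THE RAY LIMIT (two-sided)**, for every test function `fH` and every semiregular wall point `s` of the chart `S` at `w₀`
(`s w₀ 0 = s w₀ 2`, regular at the compact places `w ≠ w₀`): `stOrbFamH (insert w₀ S) (update s w₀ (x, θ₁, θ)) → stOrbFamH (insert w₀ S) (cayPt w₀ s)` as `x → 0`.  The (V1-H) reading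
★ `ArchBzSmoothBounded.tendsto_insert_cayPt_ray_nhds` without its membership hypothesis. [cite: Shelstad1979, Lemma 4.3 p. 25] [cite: Bouaziz1994IntegralesOrbitales, §3.1 (I₂) p. 579] -/
theorem tendsto_stOrbFamH_insert_cayPt_ray_nhds (hfH : ArchSmooth₂ L fH) {S : Finset {w : InfinitePlace L // IsComplex w}} {w₀ : {w : InfinitePlace L // IsComplex w}}
    {s : {w : InfinitePlace L // IsComplex w} → Fin 3 → ℝ} (hs : s w₀ 0 = s w₀ 2) (hreg : ∀ w, w ∉ S → w ≠ w₀ → Circle.exp (s w 0) ≠ Circle.exp (s w 2)) :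
    Tendsto (fun x : ℝ => stOrbFamH L νH fH (insert w₀ S) (Function.update s w₀ ![x, s w₀ 1, s w₀ 0])) (𝓝 0)
      (𝓝 (stOrbFamH L νH fH (insert w₀ S) (cayPt w₀ s))) :=
  tendsto_insert_cayPt_ray_nhds_of_contDiffOn (contDiffOn_stOrbFamH_inRegS L νH hfH (insert w₀ S)) hs hreg

/-- **One-ray form `x → 0⁺`.** [cite: Shelstad1979, Lemma 4.3 p. 25] -/
theorem tendsto_stOrbFamH_insert_cayPt_ray (hfH : ArchSmooth₂ L fH) {S : Finset {w : InfinitePlace L // IsComplex w}} {w₀ : {w : InfinitePlace L // IsComplex w}}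
    {s : {w : InfinitePlace L // IsComplex w} → Fin 3 → ℝ} (hs : s w₀ 0 = s w₀ 2) (hreg : ∀ w, w ∉ S → w ≠ w₀ → Circle.exp (s w 0) ≠ Circle.exp (s w 2)) :
    Tendsto (fun x : ℝ => stOrbFamH L νH fH (insert w₀ S) (Function.update s w₀ ![x, s w₀ 1, s w₀ 0])) (𝓝[>] 0)
      (𝓝 (stOrbFamH L νH fH (insert w₀ S) (cayPt w₀ s))) :=
  (tendsto_stOrbFamH_insert_cayPt_ray_nhds L νH hfH hs hreg).mono_left nhdsWithin_le_nhds

/-- **EQUALITY FORM** — the input shape the (J-H) assemblies compute: if `F` agrees with `stOrbFamH (insert w₀ S)` on `RegS (insert w₀ S)` (e.g. the literal reading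
`R · Σ chartOrbH`) and tends to `ℓ` along the ray for some non-trivial `l ≤ 𝓝[≠] 0`, then `stOrbFamH (insert w₀ S) (cayPt w₀ s) = ℓ` — for EVERY test function `fH`, no letter.
[cite: Shelstad1979, Lemma 4.3 p. 25] [cite: Bouaziz1994IntegralesOrbitales, §3.1 (I₂) p. 579] [cite: Varadarajan1989, §6.4 Thm 23] -/
theorem stOrbFamH_insert_cayPt_eq_of_tendsto_ray_of_le (hfH : ArchSmooth₂ L fH) {S : Finset {w : InfinitePlace L // IsComplex w}}
    {w₀ : {w : InfinitePlace L // IsComplex w}} {s : {w : InfinitePlace L // IsComplex w} → Fin 3 → ℝ} (hs : s w₀ 0 = s w₀ 2)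
    (hreg : ∀ w, w ∉ S → w ≠ w₀ → Circle.exp (s w 0) ≠ Circle.exp (s w 2)) (hregS : ∀ w ∈ S, s w 0 ≠ 0)
    {F : ({w : InfinitePlace L // IsComplex w} → Fin 3 → ℝ) → ℂ} (hEq : EqOn (stOrbFamH L νH fH (insert w₀ S)) F (RegS (insert w₀ S)))
    {l : Filter ℝ} [NeBot l] (hl : l ≤ 𝓝[≠] 0) {ℓ : ℂ} (hF : Tendsto (fun x : ℝ => F (Function.update s w₀ ![x, s w₀ 1, s w₀ 0])) l (𝓝 ℓ)) :
    stOrbFamH L νH fH (insert w₀ S) (cayPt w₀ s) = ℓ :=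
  insert_cayPt_eq_of_tendsto_ray_of_le_of_contDiffOn (contDiffOn_stOrbFamH_inRegS L νH hfH (insert w₀ S)) hs hreg hregS hEq hl hF

end Family

end Literature.NumberTheory.Rogawski1990

end
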